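import Summits.RiemannHypothesis.RiemannHypothesis.Theorems.IntegerScrewScrewPolyFloorLandauWindow
import Summits.RiemannHypothesis.RiemannHypothesis.Theorems.IntegerScrewScrewPolyFloorZeroExpansion
import HarnessLib

/-!
# Route IntegerScrew — the high zeros of the screw form: one block

Helper file for crux `IntegerScrew.ScrewPolyFloor` (stmt-RiemannHypothesis-15757), idea card
`Cruxes/ScrewPolyFloor/Ideas/abscissa-blind-head.md` (TailFloor). In the unconditional expansion
`y·S_M·y = ∑_ρ m(ρ)(−Π_ρ)/s_ρ²` (`hasSum_screwForm`; `s_ρ = ρ − ½`, `Π_ρ = P_y(s_ρ)P_y(−s_ρ)`),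
the zeros of a height block `V < |Im ρ| ≤ W` contribute, WITHOUT RH (`screwBlock_lower`):

  `Re ∑_{V<|Im ρ|≤W} m(ρ)(−Π_ρ)/s_ρ² ≥ [margin(V,W)/W² − M²(N_±(W) − N_±(V))((W²−V²)/(V²W²) + 2/V³)]·∑y²`

where `margin(V,W) = ((W−V)/π)(log(V/2π) − log M − 1) − C(log W + M⁵log²W)` is the RH-free window
margin of the Landau pairing (`pairing_window_positive`): write
`−Π/s² = Π/W² + Π(1/γ² − 1/W²) − Π(1/s² + 1/γ²)` (`γ = Im ρ`), use `|Π_ρ| ≤ M² ∑y²`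
(`norm_pairing_le`, `|Re s_ρ| < ½`) and `|1/s² + 1/γ²| ≤ 2/|γ|³` (`norm_inv_sq_add_inv_sq_le`).
Also: the reindexing `zerosUpTo T ↔ weilZeroIndex T` (`sum_zerosUpTo_eq_sum_weilZeroIndex`) and the
upper Riemann–von Mangoldt count in a window (`zetaZeroCount_window_upper`).
-/

noncomputable section

open Complex Finset Filter
open scoped Real Topology

-- the layout-mandated namespace repeats the summit name
set_option linter.dupNamespace false

namespace Summit.RiemannHypothesis.RiemannHypothesis.Theorems.IntegerScrewLandau

open Literature.NumberTheory.LFunctions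

/-! ### Reindexing: `zerosUpTo T` (subtype) versus `weilZeroIndex T` (set of `ℂ`) -/

/-- A sum over the non-trivial zeros with `|Im ρ| ≤ T`, as a `Finset` of the subtype
(`SchoenfeldBound.zerosUpTo`) or of `ℂ` (`weilZeroIndex`). [folklore] -/
theorem sum_zerosUpTo_eq_sum_weilZeroIndex (T : ℝ) (g : ℂ → ℂ) :
    ∑ ρ ∈ SchoenfeldBound.zerosUpTo T, g (ρ : ℂ) = ∑ z ∈ (weilZeroIndex_finite T).toFinset, g z := by
  classical
  refine Finset.sum_bij (fun (ρ : NicolasJExplicit.Zeros) _ ↦ (ρ : ℂ)) (fun ρ hρ ↦ ?_)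
    (fun ρ₁ _ ρ₂ _ h ↦ Subtype.ext h) (fun z hz ↦ ?_) (fun ρ _ ↦ rfl)
  · rw [SchoenfeldBound.mem_zerosUpTo] at hρ
    rw [mem_weilZeroIndex_toFinset]
    have hmem : (ρ : ℂ) ∈ RHWave0.riemannZetaNontrivialZeros := ρ.2
    exact ⟨ZetaZeros.riemannZetaNontrivialZeros.zeta_eq_zero hmem,
      (ZetaZeros.riemannZetaNontrivialZeros.re_pos hmem).le,
      (ZetaZeros.riemannZetaNontrivialZeros.re_lt_one hmem).le,
      ZetaZeros.riemannZetaNontrivialZeros.im_ne_zero hmem, hρ⟩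
  · rw [mem_weilZeroIndex_toFinset] at hz
    obtain ⟨h0, -, -, him, habs⟩ := hz
    have hmem := ZetaZeros.riemannZetaNontrivialZeros.mem_of_im_ne_zero h0 him
    refine ⟨⟨z, hmem⟩, ?_, rfl⟩
    rw [SchoenfeldBound.mem_zerosUpTo]
    exact habs

/-- Real-valued version. [folklore] -/
theorem sum_zerosUpTo_eq_sum_weilZeroIndex_real (T : ℝ) (g : ℂ → ℝ) :
    ∑ ρ ∈ SchoenfeldBound.zerosUpTo T, g (ρ : ℂ) = ∑ z ∈ (weilZeroIndex_finite T).toFinset, g z := by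
  have h := sum_zerosUpTo_eq_sum_weilZeroIndex T (fun z ↦ (g z : ℂ))
  exact_mod_cast h

/-! ### Sizes: the Dirichlet polynomial, the pairing, the weights -/

/-- `‖P_y(s)‖ ≤ √M ∑|y_m|` for `Re s ≤ ½` (`|m^s| = m^{Re s} ≤ √M`). [folklore] -/
theorem norm_dirPoly_le (M : ℕ) (y : ℕ → ℝ) {s : ℂ} (hs : s.re ≤ 1 / 2) :
    ‖∑ m ∈ Icc 1 M, ((y m : ℝ) : ℂ) * (m : ℂ) ^ s‖ ≤ Real.sqrt M * ∑ m ∈ Icc 1 M, |y m| := by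
  rw [Finset.mul_sum]
  refine (norm_sum_le _ _).trans (Finset.sum_le_sum fun m hm ↦ ?_)
  rw [Finset.mem_Icc] at hm
  have hm0 : 0 < m := hm.1
  have hmR : (1 : ℝ) ≤ m := by exact_mod_cast hm.1
  have hmM : (m : ℝ) ≤ M := by exact_mod_cast hm.2
  rw [norm_mul, Complex.norm_real, Real.norm_eq_abs, Complex.norm_natCast_cpow_of_pos hm0, mul_comm]
  refine mul_le_mul_of_nonneg_right ?_ (abs_nonneg _)
  calc (m : ℝ) ^ s.re ≤ (m : ℝ) ^ (1 / 2 : ℝ) := Real.rpow_le_rpow_of_exponent_le hmR hs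
    _ ≤ (M : ℝ) ^ (1 / 2 : ℝ) := Real.rpow_le_rpow (by positivity) hmM (by norm_num)
    _ = Real.sqrt M := (Real.sqrt_eq_rpow (M : ℝ)).symm

/-- **The pairing is `≤ M² ∑y²`.** For `|Re s| ≤ ½`:
`‖P_y(s) P_y(−s)‖ ≤ M² ∑_{m ≤ M} y_m²`. [folklore] -/
theorem norm_pairing_le (M : ℕ) (y : ℕ → ℝ) {s : ℂ} (hs : |s.re| ≤ 1 / 2) :
    ‖(∑ m ∈ Icc 1 M, ((y m : ℝ) : ℂ) * (m : ℂ) ^ s) *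
        ∑ m ∈ Icc 1 M, ((y m : ℝ) : ℂ) * (m : ℂ) ^ (-s)‖ ≤
      (M : ℝ) ^ 2 * ∑ m ∈ Icc 1 M, y m ^ 2 := by
  have h1 := norm_dirPoly_le M y (s := s) (abs_le.1 hs).2
  have h2 := norm_dirPoly_le M y (s := -s) (by rw [neg_re]; linarith [(abs_le.1 hs).1])
  have hA : 0 ≤ ∑ m ∈ Icc 1 M, |y m| := Finset.sum_nonneg fun _ _ ↦ abs_nonneg _
  have hCS := sq_sum_abs_le M y
  rw [norm_mul]
  calc ‖∑ m ∈ Icc 1 M, ((y m : ℝ) : ℂ) * (m : ℂ) ^ s‖ * ‖∑ m ∈ Icc 1 M, ((y m : ℝ) : ℂ) * (m : ℂ) ^ (-s)‖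
      ≤ (Real.sqrt M * ∑ m ∈ Icc 1 M, |y m|) * (Real.sqrt M * ∑ m ∈ Icc 1 M, |y m|) :=
        mul_le_mul h1 h2 (norm_nonneg _) (by positivity)
    _ = M * (∑ m ∈ Icc 1 M, |y m|) ^ 2 := by
        rw [show Real.sqrt M * (∑ m ∈ Icc 1 M, |y m|) * (Real.sqrt M * ∑ m ∈ Icc 1 M, |y m|) =
          (Real.sqrt M * Real.sqrt M) * (∑ m ∈ Icc 1 M, |y m|) ^ 2 by ring,
          Real.mul_self_sqrt (Nat.cast_nonneg M)]
    _ ≤ M * (M * ∑ m ∈ Icc 1 M, y m ^ 2) := mul_le_mul_of_nonneg_left hCS (Nat.cast_nonneg M)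
    _ = (M : ℝ) ^ 2 * ∑ m ∈ Icc 1 M, y m ^ 2 := by ring

/-- **The weight is `−1/γ²` up to `2/|γ|³`.** For `s = σ + iγ` with `|σ| ≤ ½`, `|γ| ≥ 1`:
`‖1/s² + 1/γ²‖ ≤ 2/|γ|³` (`s² + γ² = σ(σ + 2iγ)`, `|s²| ≥ γ²`). [folklore] -/
theorem norm_inv_sq_add_inv_sq_le {s : ℂ} (hσ : |s.re| ≤ 1 / 2) (hγ : 1 ≤ |s.im|) :
    ‖(s ^ 2)⁻¹ + (((s.im ^ 2 : ℝ)) : ℂ)⁻¹‖ ≤ 2 / |s.im| ^ 3 := by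
  have hγ0 : s.im ≠ 0 := fun h ↦ by rw [h, abs_zero] at hγ; linarith
  have hs0 : s ≠ 0 := fun h ↦ hγ0 (by rw [h]; simp)
  have hs2 : s ^ 2 ≠ 0 := pow_ne_zero 2 hs0
  have hg2 : (((s.im ^ 2 : ℝ)) : ℂ) ≠ 0 := by
    exact_mod_cast pow_ne_zero 2 hγ0
  -- algebra: `1/s² + 1/γ² = (s² + γ²)/(s² γ²)` and `s² + γ² = σ (σ + 2iγ)`
  have hsum : (s ^ 2)⁻¹ + (((s.im ^ 2 : ℝ)) : ℂ)⁻¹ = (s ^ 2 + ((s.im ^ 2 : ℝ) : ℂ)) / (s ^ 2 * ((s.im ^ 2 : ℝ) : ℂ)) := by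
    field_simp
    ring
  have hfac : s ^ 2 + ((s.im ^ 2 : ℝ) : ℂ) = (s.re : ℂ) * ((s.re : ℂ) + 2 * (s.im : ℂ) * I) := by
    apply Complex.ext
    · simp [sq, Complex.mul_re, Complex.mul_im]
    · simp [sq, Complex.mul_re, Complex.mul_im]; ring
  rw [hsum, hfac, norm_div, norm_mul, norm_mul, norm_pow, Complex.norm_real, Complex.norm_real,
    Real.norm_eq_abs, Real.norm_eq_abs, abs_pow]
  -- sizes
  have h1 : ‖(s.re : ℂ) + 2 * (s.im : ℂ) * I‖ ≤ |s.re| + 2 * |s.im| := by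
    calc ‖(s.re : ℂ) + 2 * (s.im : ℂ) * I‖ ≤ ‖(s.re : ℂ)‖ + ‖2 * (s.im : ℂ) * I‖ := norm_add_le _ _
      _ = |s.re| + 2 * |s.im| := by
          rw [Complex.norm_real, Real.norm_eq_abs, norm_mul, norm_mul, Complex.norm_I, mul_one,
            Complex.norm_real, Real.norm_eq_abs, Complex.norm_two]
  have hγabs : 0 < |s.im| := by linarith
  have hnorm : |s.im| ≤ ‖s‖ := Complex.abs_im_le_norm s
  have hs_pos : 0 < ‖s‖ := norm_pos_iff.2 hs0
  have hnum : |s.re| * ‖(s.re : ℂ) + 2 * (s.im : ℂ) * I‖ ≤ 2 * |s.im| := by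
    calc |s.re| * ‖(s.re : ℂ) + 2 * (s.im : ℂ) * I‖ ≤ (1 / 2) * (|s.re| + 2 * |s.im|) :=
          mul_le_mul hσ h1 (norm_nonneg _) (by norm_num)
      _ ≤ (1 / 2) * (1 / 2 * |s.im| + 2 * |s.im|) := by
          gcongr
          linarith
      _ ≤ 2 * |s.im| := by linarith
  have hden : |s.im| ^ 2 * |s.im| ^ 2 ≤ ‖s‖ ^ 2 * |s.im| ^ 2 := by
    gcongr
  rw [div_le_div_iff₀ (by positivity) (by positivity)]
  calc |s.re| * ‖(s.re : ℂ) + 2 * (s.im : ℂ) * I‖ * |s.im| ^ 3 ≤ 2 * |s.im| * |s.im| ^ 3 := by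
        gcongr
    _ = 2 * (|s.im| ^ 2 * |s.im| ^ 2) := by ring
    _ ≤ 2 * (‖s‖ ^ 2 * |s.im| ^ 2) := by gcongr

/-! ### The zero count in a window from above -/

/-- **Zeros in a window, upper bound.** From `riemann_von_mangoldt_holds`: there are `C > 0` and
`T* ≥ 2` with `N(T₂) − N(T₁) ≤ ((T₂ − T₁)/2π) log(T₂/2π) + C log T₂` for all `T* ≤ T₁ ≤ T₂`
(concavity: `f(T₂) − f(T₁) ≤ (T₂ − T₁) f'(T₂)`). [folklore] -/
theorem zetaZeroCount_window_upper :
    ∃ C T₀ : ℝ, 0 < C ∧ 2 ≤ T₀ ∧ ∀ T₁ T₂ : ℝ, T₀ ≤ T₁ → T₁ ≤ T₂ →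
      (zetaZeroCount T₂ : ℝ) - zetaZeroCount T₁ ≤
        (T₂ - T₁) / (2 * π) * Real.log (T₂ / (2 * π)) + C * Real.log T₂ := by
  have h : riemann_von_mangoldt := riemann_von_mangoldt_holds
  unfold riemann_von_mangoldt at h
  obtain ⟨c, hc⟩ := h.bound
  rw [Filter.eventually_atTop] at hc
  obtain ⟨T₀, hT₀⟩ := hc
  refine ⟨2 * max c 1, max T₀ 2, by positivity, le_max_right _ _, fun T₁ T₂ h1 h12 ↦ ?_⟩
  have hT₁2 : 2 ≤ T₁ := (le_max_right _ _).trans h1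
  have hT₁0 : 0 < T₁ := by linarith
  have hT₂0 : 0 < T₂ := by linarith
  have hb1 := hT₀ T₁ ((le_max_left _ _).trans h1)
  have hb2 := hT₀ T₂ ((le_max_left _ _).trans (h1.trans h12))
  have hlog1 : 0 ≤ Real.log T₁ := Real.log_nonneg (by linarith)
  have hlog2 : 0 ≤ Real.log T₂ := Real.log_nonneg (by linarith)
  have hlog12 : Real.log T₁ ≤ Real.log T₂ := Real.log_le_log hT₁0 h12
  rw [Real.norm_eq_abs, Real.norm_eq_abs, abs_of_nonneg hlog1] at hb1
  rw [Real.norm_eq_abs, Real.norm_eq_abs, abs_of_nonneg hlog2] at hb2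
  -- concavity of the main term
  have hmain : (T₂ / (2 * π) * Real.log (T₂ / (2 * π)) - T₂ / (2 * π)) -
      (T₁ / (2 * π) * Real.log (T₁ / (2 * π)) - T₁ / (2 * π)) ≤
      (T₂ - T₁) / (2 * π) * Real.log (T₂ / (2 * π)) := by
    have hπ : 0 < 2 * π := by positivity
    have hlog : Real.log (T₂ / (2 * π)) - Real.log (T₁ / (2 * π)) ≤ T₂ / T₁ - 1 := by
      rw [← Real.log_div (by positivity) (by positivity), div_div_div_cancel_right₀ hπ.ne']
      exact Real.log_le_sub_one_of_pos (div_pos hT₂0 hT₁0)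
    have h4 : 0 ≤ T₁ / (2 * π) := by positivity
    have key := mul_le_mul_of_nonneg_left hlog h4
    have e1 : T₁ / (2 * π) * (T₂ / T₁ - 1) = (T₂ - T₁) / (2 * π) := by field_simp
    have e : (T₂ - T₁) / (2 * π) * Real.log (T₂ / (2 * π)) -
        ((T₂ / (2 * π) * Real.log (T₂ / (2 * π)) - T₂ / (2 * π)) -
          (T₁ / (2 * π) * Real.log (T₁ / (2 * π)) - T₁ / (2 * π))) =
        (T₂ - T₁) / (2 * π) - T₁ / (2 * π) * (Real.log (T₂ / (2 * π)) - Real.log (T₁ / (2 * π))) := by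
      ring
    rw [e1] at key
    linarith [key, e]
  have hc1 : c ≤ max c 1 := le_max_left _ _
  have hm0 : 0 ≤ max c 1 := le_trans zero_le_one (le_max_right _ _)
  have e1 := (abs_le.1 hb1).1
  have e2 := (abs_le.1 hb2).2
  have p1 : c * Real.log T₁ ≤ max c 1 * Real.log T₂ := by
    calc c * Real.log T₁ ≤ max c 1 * Real.log T₁ := mul_le_mul_of_nonneg_right hc1 hlog1
      _ ≤ max c 1 * Real.log T₂ := mul_le_mul_of_nonneg_left hlog12 hm0
  have p2 : c * Real.log T₂ ≤ max c 1 * Real.log T₂ := mul_le_mul_of_nonneg_right hc1 hlog2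
  linarith

/-! ### One block of high zeros -/

/-- **One block of the tail, without RH.** Let `C, T₀` be constants for which the window bound of
`pairing_window_positive` holds. For `M ≥ 1`, real `y`, `T₀ ≤ V ≤ W`, the zeros with
`V < |Im ρ| ≤ W` contribute to the expansion of the screw form at least
`[margin(V,W)/W² − M² (N_±(W) − N_±(V)) ((W² − V²)/(V²W²) + 2/V³)] ∑ y_m²`,
`margin(V,W) = ((W−V)/π)(log(V/2π) − log M − 1) − C(log W + M⁵ log²W)`, `N_±(T) = ∑_{|Im ρ| ≤ T} m(ρ)`
(decomposition `−Π/s² = Π/W² + Π(1/γ² − 1/W²) − Π(1/s² + 1/γ²)`, `|Π| ≤ M²∑y²`,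
`0 ≤ 1/γ² − 1/W² ≤ 1/V² − 1/W²`, `|1/s² + 1/γ²| ≤ 2/|γ|³ ≤ 2/V³`). [folklore] -/
theorem screwBlock_lower {C T₀ : ℝ} (hT₀ : 2 ≤ T₀)
    (hpos : ∀ (M : ℕ), 1 ≤ M → ∀ (y : ℕ → ℝ) (T₁ T₂ : ℝ), T₀ ≤ T₁ → T₁ ≤ T₂ →
      ((T₂ - T₁) / π * (Real.log (T₁ / (2 * π)) - Real.log M - 1) -
          C * (Real.log T₂ + (M : ℝ) ^ 5 * Real.log T₂ ^ 2)) * ∑ m ∈ Icc 1 M, y m ^ 2 ≤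
      ((∑ ρ ∈ (weilZeroIndex_finite T₂).toFinset, (riemannZetaZeroOrder ρ : ℂ) *
          ((∑ m ∈ Icc 1 M, (y m : ℂ) * (m : ℂ) ^ (ρ - 1 / 2)) *
            (∑ m ∈ Icc 1 M, (y m : ℂ) * (m : ℂ) ^ (-(ρ - 1 / 2))))) -
        ∑ ρ ∈ (weilZeroIndex_finite T₁).toFinset, (riemannZetaZeroOrder ρ : ℂ) *
          ((∑ m ∈ Icc 1 M, (y m : ℂ) * (m : ℂ) ^ (ρ - 1 / 2)) *
            (∑ m ∈ Icc 1 M, (y m : ℂ) * (m : ℂ) ^ (-(ρ - 1 / 2))))).re)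
    {M : ℕ} (hM : 1 ≤ M) (y : ℕ → ℝ) {V W : ℝ} (hV : T₀ ≤ V) (hVW : V ≤ W) :
    ((((W - V) / π * (Real.log (V / (2 * π)) - Real.log M - 1) -
          C * (Real.log W + (M : ℝ) ^ 5 * Real.log W ^ 2)) / W ^ 2 -
        (M : ℝ) ^ 2 * ((∑ ρ ∈ SchoenfeldBound.zerosUpTo W, (riemannZetaZeroOrder (ρ : ℂ) : ℝ)) -
            ∑ ρ ∈ SchoenfeldBound.zerosUpTo V, (riemannZetaZeroOrder (ρ : ℂ) : ℝ)) *
          ((W ^ 2 - V ^ 2) / (V ^ 2 * W ^ 2) + 2 / V ^ 3)) * ∑ m ∈ Icc 1 M, y m ^ 2) ≤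
      (∑ ρ ∈ SchoenfeldBound.zerosUpTo W \ SchoenfeldBound.zerosUpTo V,
        (riemannZetaZeroOrder (ρ : ℂ) : ℂ) *
          (-((∑ m ∈ Icc 1 M, ((y m : ℝ) : ℂ) * (m : ℂ) ^ ((ρ : ℂ) - 1 / 2)) *
              ∑ m ∈ Icc 1 M, ((y m : ℝ) : ℂ) * (m : ℂ) ^ (-((ρ : ℂ) - 1 / 2))) /
            ((ρ : ℂ) - 1 / 2) ^ 2)).re := by
  classical
  have hV2 : 2 ≤ V := hT₀.trans hV
  have hV0 : 0 < V := by linarith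
  have hW0 : 0 < W := by linarith
  set S : ℝ := ∑ m ∈ Icc 1 M, y m ^ 2 with hS
  have hS0 : 0 ≤ S := Finset.sum_nonneg fun _ _ ↦ sq_nonneg _
  set B := SchoenfeldBound.zerosUpTo W \ SchoenfeldBound.zerosUpTo V with hB
  -- notation for the summand
  set Pf : ℂ → ℂ := fun z ↦ (∑ m ∈ Icc 1 M, ((y m : ℝ) : ℂ) * (m : ℂ) ^ (z - 1 / 2)) *
    ∑ m ∈ Icc 1 M, ((y m : ℝ) : ℂ) * (m : ℂ) ^ (-(z - 1 / 2)) with hPf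
  set mf : ℂ → ℂ := fun z ↦ (riemannZetaZeroOrder z : ℂ) with hmf
  -- facts about the zeros of the block
  have hBmem : ∀ ρ ∈ B, V < |(ρ : ℂ).im| ∧ |(ρ : ℂ).im| ≤ W := by
    intro ρ hρ
    rw [hB, Finset.mem_sdiff, SchoenfeldBound.mem_zerosUpTo, SchoenfeldBound.mem_zerosUpTo, not_le] at hρ
    exact ⟨hρ.2, hρ.1⟩
  have hre : ∀ ρ : NicolasJExplicit.Zeros, |((ρ : ℂ) - 1 / 2).re| ≤ 1 / 2 := by
    intro ρ
    have h1 := ZetaZeros.riemannZetaNontrivialZeros.re_pos ρ.2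
    have h2 := ZetaZeros.riemannZetaNontrivialZeros.re_lt_one ρ.2
    rw [abs_le]
    simp only [Complex.sub_re, Complex.div_ofNat_re, Complex.one_re]
    constructor <;> linarith
  have hsim : ∀ ρ : NicolasJExplicit.Zeros, ((ρ : ℂ) - 1 / 2).im = (ρ : ℂ).im := by
    intro ρ; simp
  have hm0 : ∀ ρ : NicolasJExplicit.Zeros, (0 : ℝ) ≤ riemannZetaZeroOrder (ρ : ℂ) := fun ρ ↦ by
    exact_mod_cast riemannZetaZeroOrder_nonneg (ZetaZeros.riemannZetaNontrivialZeros.ne_one ρ.2)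
  have hmnorm : ∀ ρ : NicolasJExplicit.Zeros, ‖mf (ρ : ℂ)‖ = riemannZetaZeroOrder (ρ : ℂ) := fun ρ ↦ by
    simp only [hmf]; rw [Complex.norm_intCast, abs_of_nonneg (hm0 ρ)]
  have hPi : ∀ ρ : NicolasJExplicit.Zeros, ‖Pf (ρ : ℂ)‖ ≤ (M : ℝ) ^ 2 * S := fun ρ ↦ by
    simp only [hPf]; exact norm_pairing_le M y (hre ρ)
  -- the termwise decomposition of the summand
  have hdecomp : ∀ ρ : NicolasJExplicit.Zeros,
      mf (ρ : ℂ) * (-Pf (ρ : ℂ) / ((ρ : ℂ) - 1 / 2) ^ 2) =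
        ((W ^ 2 : ℝ) : ℂ)⁻¹ * (mf (ρ : ℂ) * Pf (ρ : ℂ)) +
          mf (ρ : ℂ) * Pf (ρ : ℂ) * ((((((ρ : ℂ) - 1 / 2).im ^ 2 : ℝ)) : ℂ)⁻¹ - ((W ^ 2 : ℝ) : ℂ)⁻¹) -
          mf (ρ : ℂ) * Pf (ρ : ℂ) *
            ((((ρ : ℂ) - 1 / 2) ^ 2)⁻¹ + (((((ρ : ℂ) - 1 / 2).im ^ 2 : ℝ)) : ℂ)⁻¹) := by
    intro ρ
    rw [div_eq_mul_inv]
    ring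
  have hsumB : ∑ ρ ∈ B, mf (ρ : ℂ) * (-Pf (ρ : ℂ) / ((ρ : ℂ) - 1 / 2) ^ 2) =
      ((W ^ 2 : ℝ) : ℂ)⁻¹ * ∑ ρ ∈ B, mf (ρ : ℂ) * Pf (ρ : ℂ) +
        ∑ ρ ∈ B, mf (ρ : ℂ) * Pf (ρ : ℂ) *
            ((((((ρ : ℂ) - 1 / 2).im ^ 2 : ℝ)) : ℂ)⁻¹ - ((W ^ 2 : ℝ) : ℂ)⁻¹) -
        ∑ ρ ∈ B, mf (ρ : ℂ) * Pf (ρ : ℂ) *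
            ((((ρ : ℂ) - 1 / 2) ^ 2)⁻¹ + (((((ρ : ℂ) - 1 / 2).im ^ 2 : ℝ)) : ℂ)⁻¹) := by
    rw [Finset.sum_congr rfl fun ρ _ ↦ hdecomp ρ, Finset.sum_sub_distrib, Finset.sum_add_distrib,
      Finset.mul_sum]
  -- (i) the main term: the pairing over the block
  have hsub : SchoenfeldBound.zerosUpTo V ⊆ SchoenfeldBound.zerosUpTo W :=
    SchoenfeldBound.zerosUpTo_subset hVW
  have hmainB : ∑ ρ ∈ B, mf (ρ : ℂ) * Pf (ρ : ℂ) =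
      (∑ z ∈ (weilZeroIndex_finite W).toFinset, mf z * Pf z) -
        ∑ z ∈ (weilZeroIndex_finite V).toFinset, mf z * Pf z := by
    rw [hB, Finset.sum_sdiff_eq_sub hsub, sum_zerosUpTo_eq_sum_weilZeroIndex W (fun z ↦ mf z * Pf z),
      sum_zerosUpTo_eq_sum_weilZeroIndex V (fun z ↦ mf z * Pf z)]
  have hmain : ((W - V) / π * (Real.log (V / (2 * π)) - Real.log M - 1) -
      C * (Real.log W + (M : ℝ) ^ 5 * Real.log W ^ 2)) * S ≤
      (∑ ρ ∈ B, mf (ρ : ℂ) * Pf (ρ : ℂ)).re := by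
    rw [hmainB]
    have h := hpos M hM y V W hV hVW
    simp only [hmf, hPf, hS]
    exact h
  -- the count over the block
  have hcountB : ∑ ρ ∈ B, (riemannZetaZeroOrder (ρ : ℂ) : ℝ) =
      (∑ ρ ∈ SchoenfeldBound.zerosUpTo W, (riemannZetaZeroOrder (ρ : ℂ) : ℝ)) -
        ∑ ρ ∈ SchoenfeldBound.zerosUpTo V, (riemannZetaZeroOrder (ρ : ℂ) : ℝ) := by
    rw [hB, Finset.sum_sdiff_eq_sub hsub]
  set ΔN : ℝ := (∑ ρ ∈ SchoenfeldBound.zerosUpTo W, (riemannZetaZeroOrder (ρ : ℂ) : ℝ)) -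
    ∑ ρ ∈ SchoenfeldBound.zerosUpTo V, (riemannZetaZeroOrder (ρ : ℂ) : ℝ) with hΔN
  -- (ii) the weight shift `1/γ² − 1/W²`
  have hshift : -((M : ℝ) ^ 2 * S * ((W ^ 2 - V ^ 2) / (V ^ 2 * W ^ 2)) * ΔN) ≤
      (∑ ρ ∈ B, mf (ρ : ℂ) * Pf (ρ : ℂ) *
        ((((((ρ : ℂ) - 1 / 2).im ^ 2 : ℝ)) : ℂ)⁻¹ - ((W ^ 2 : ℝ) : ℂ)⁻¹)).re := by
    have hterm : ∀ ρ ∈ B, ‖mf (ρ : ℂ) * Pf (ρ : ℂ) *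
        ((((((ρ : ℂ) - 1 / 2).im ^ 2 : ℝ)) : ℂ)⁻¹ - ((W ^ 2 : ℝ) : ℂ)⁻¹)‖ ≤
        (M : ℝ) ^ 2 * S * ((W ^ 2 - V ^ 2) / (V ^ 2 * W ^ 2)) * riemannZetaZeroOrder (ρ : ℂ) := by
      intro ρ hρ
      obtain ⟨hlo, hhi⟩ := hBmem ρ hρ
      have hγ0 : 0 < |(ρ : ℂ).im| := by linarith
      have hwt : (((((ρ : ℂ) - 1 / 2).im ^ 2 : ℝ)) : ℂ)⁻¹ - ((W ^ 2 : ℝ) : ℂ)⁻¹ =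
          (((((ρ : ℂ).im ^ 2)⁻¹ - (W ^ 2)⁻¹ : ℝ)) : ℂ) := by
        rw [hsim]; push_cast; ring
      have hwt0 : 0 ≤ ((ρ : ℂ).im ^ 2)⁻¹ - (W ^ 2)⁻¹ := by
        rw [sub_nonneg]
        refine inv_anti₀ (by rw [← sq_abs]; exact pow_pos hγ0 2) ?_
        calc (ρ : ℂ).im ^ 2 = |(ρ : ℂ).im| ^ 2 := (sq_abs _).symm
          _ ≤ W ^ 2 := pow_le_pow_left₀ hγ0.le hhi 2
      have hwt1 : ((ρ : ℂ).im ^ 2)⁻¹ - (W ^ 2)⁻¹ ≤ (W ^ 2 - V ^ 2) / (V ^ 2 * W ^ 2) := by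
        have e : (W ^ 2 - V ^ 2) / (V ^ 2 * W ^ 2) = (V ^ 2)⁻¹ - (W ^ 2)⁻¹ := by
          field_simp
        rw [e]
        refine sub_le_sub_right (inv_anti₀ (by positivity) ?_) _
        calc V ^ 2 ≤ |(ρ : ℂ).im| ^ 2 := pow_le_pow_left₀ hV0.le hlo.le 2
          _ = (ρ : ℂ).im ^ 2 := sq_abs _
      rw [hwt, norm_mul, norm_mul, hmnorm, Complex.norm_real, Real.norm_eq_abs, abs_of_nonneg hwt0]
      calc riemannZetaZeroOrder (ρ : ℂ) * ‖Pf (ρ : ℂ)‖ * (((ρ : ℂ).im ^ 2)⁻¹ - (W ^ 2)⁻¹)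
          ≤ riemannZetaZeroOrder (ρ : ℂ) * ((M : ℝ) ^ 2 * S) * ((W ^ 2 - V ^ 2) / (V ^ 2 * W ^ 2)) :=
            mul_le_mul (mul_le_mul_of_nonneg_left (hPi ρ) (hm0 ρ)) hwt1 hwt0
              (mul_nonneg (hm0 ρ) (by positivity))
        _ = (M : ℝ) ^ 2 * S * ((W ^ 2 - V ^ 2) / (V ^ 2 * W ^ 2)) * riemannZetaZeroOrder (ρ : ℂ) := by ring
    have hn := (Complex.abs_re_le_norm _).trans ((norm_sum_le _ _).trans (Finset.sum_le_sum hterm))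
    rw [← Finset.mul_sum, hcountB] at hn
    linarith [(abs_le.1 hn).1]
  -- (iii) the weight defect `1/s² + 1/γ²`
  have hdefect : |(∑ ρ ∈ B, mf (ρ : ℂ) * Pf (ρ : ℂ) *
        ((((ρ : ℂ) - 1 / 2) ^ 2)⁻¹ + (((((ρ : ℂ) - 1 / 2).im ^ 2 : ℝ)) : ℂ)⁻¹)).re| ≤
      (M : ℝ) ^ 2 * S * (2 / V ^ 3) * ΔN := by
    have hterm : ∀ ρ ∈ B, ‖mf (ρ : ℂ) * Pf (ρ : ℂ) *
        ((((ρ : ℂ) - 1 / 2) ^ 2)⁻¹ + (((((ρ : ℂ) - 1 / 2).im ^ 2 : ℝ)) : ℂ)⁻¹)‖ ≤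
        (M : ℝ) ^ 2 * S * (2 / V ^ 3) * riemannZetaZeroOrder (ρ : ℂ) := by
      intro ρ hρ
      obtain ⟨hlo, hhi⟩ := hBmem ρ hρ
      have hγ1 : 1 ≤ |((ρ : ℂ) - 1 / 2).im| := by rw [hsim]; linarith
      have hw := norm_inv_sq_add_inv_sq_le (hre ρ) hγ1
      have hw' : 2 / |((ρ : ℂ) - 1 / 2).im| ^ 3 ≤ 2 / V ^ 3 := by
        rw [hsim]
        exact div_le_div_of_nonneg_left (by norm_num) (by positivity) (pow_le_pow_left₀ hV0.le hlo.le 3)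
      rw [norm_mul, norm_mul, hmnorm]
      calc riemannZetaZeroOrder (ρ : ℂ) * ‖Pf (ρ : ℂ)‖ *
            ‖(((ρ : ℂ) - 1 / 2) ^ 2)⁻¹ + (((((ρ : ℂ) - 1 / 2).im ^ 2 : ℝ)) : ℂ)⁻¹‖
          ≤ riemannZetaZeroOrder (ρ : ℂ) * ((M : ℝ) ^ 2 * S) * (2 / V ^ 3) := by
            refine mul_le_mul (mul_le_mul_of_nonneg_left (hPi ρ) (hm0 ρ)) (hw.trans hw')
              (norm_nonneg _) (mul_nonneg (hm0 ρ) (by positivity))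
        _ = (M : ℝ) ^ 2 * S * (2 / V ^ 3) * riemannZetaZeroOrder (ρ : ℂ) := by ring
    have hn := (Complex.abs_re_le_norm _).trans ((norm_sum_le _ _).trans (Finset.sum_le_sum hterm))
    rw [← Finset.mul_sum, hcountB] at hn
    exact hn
  -- assemble
  have hW2 : (((W ^ 2 : ℝ) : ℂ)⁻¹ * ∑ ρ ∈ B, mf (ρ : ℂ) * Pf (ρ : ℂ)).re =
      (W ^ 2)⁻¹ * (∑ ρ ∈ B, mf (ρ : ℂ) * Pf (ρ : ℂ)).re := by
    rw [← Complex.ofReal_inv, Complex.re_ofReal_mul]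
  have hgoal : (∑ ρ ∈ B, (riemannZetaZeroOrder (ρ : ℂ) : ℂ) *
      (-((∑ m ∈ Icc 1 M, ((y m : ℝ) : ℂ) * (m : ℂ) ^ ((ρ : ℂ) - 1 / 2)) *
          ∑ m ∈ Icc 1 M, ((y m : ℝ) : ℂ) * (m : ℂ) ^ (-((ρ : ℂ) - 1 / 2))) /
        ((ρ : ℂ) - 1 / 2) ^ 2)).re =
      (W ^ 2)⁻¹ * (∑ ρ ∈ B, mf (ρ : ℂ) * Pf (ρ : ℂ)).re +
        (∑ ρ ∈ B, mf (ρ : ℂ) * Pf (ρ : ℂ) *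
          ((((((ρ : ℂ) - 1 / 2).im ^ 2 : ℝ)) : ℂ)⁻¹ - ((W ^ 2 : ℝ) : ℂ)⁻¹)).re -
        (∑ ρ ∈ B, mf (ρ : ℂ) * Pf (ρ : ℂ) *
          ((((ρ : ℂ) - 1 / 2) ^ 2)⁻¹ + (((((ρ : ℂ) - 1 / 2).im ^ 2 : ℝ)) : ℂ)⁻¹)).re := by
    have h := congrArg Complex.re hsumB
    rw [Complex.sub_re, Complex.add_re, hW2] at h
    simp only [hmf, hPf] at h ⊢
    exact h
  rw [hgoal]
  have hWinv : 0 < (W ^ 2)⁻¹ := by positivity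
  have h1 := mul_le_mul_of_nonneg_left hmain hWinv.le
  have h3 := (abs_le.1 hdefect).2
  have e : ((((W - V) / π * (Real.log (V / (2 * π)) - Real.log M - 1) -
          C * (Real.log W + (M : ℝ) ^ 5 * Real.log W ^ 2)) / W ^ 2 -
        (M : ℝ) ^ 2 * ΔN * ((W ^ 2 - V ^ 2) / (V ^ 2 * W ^ 2) + 2 / V ^ 3)) * S) =
      (W ^ 2)⁻¹ * (((W - V) / π * (Real.log (V / (2 * π)) - Real.log M - 1) -
          C * (Real.log W + (M : ℝ) ^ 5 * Real.log W ^ 2)) * S) -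
        (M : ℝ) ^ 2 * S * ((W ^ 2 - V ^ 2) / (V ^ 2 * W ^ 2)) * ΔN -
        (M : ℝ) ^ 2 * S * (2 / V ^ 3) * ΔN := by
    rw [div_eq_mul_inv]; ring
  rw [e]
  linarith

end Summit.RiemannHypothesis.RiemannHypothesis.Theorems.IntegerScrewLandau

end
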